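import Literature.NumberTheory.EllipticCurves.RibetTakahashiDefinite
import Literature.NumberTheory.EllipticCurves.TakahashiDegreeFormula
import Literature.NumberTheory.Automorphic.BrandtModuleDictionary
import Literature.NumberTheory.Automorphic.BrandtModuleEichlerPackageProofs
import HarnessLib

/-!
# The definite Ribet–Takahashi formula at a PRIME `N⁻ = q` and ARBITRARY `N⁺ = M`:
# `ord_p η_f(Mq) = ord_p ξ_f(M, q)` whenever `p ∤ c_q` (theorems only; no new fact)

Topic `Literature/NumberTheory/EllipticCurves`; sibling of `RibetTakahashiDefinite.lean` (Pollack–Weston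
2011 Thm. 6.8 at SQUARE-FREE level) and of `WZhang2014/DefiniteCongruenceNumber.lean` (W. Zhang 2014
Thm. 6.4 at arbitrary level under Hypothesis ♥, a named fact). PROVED here, in the case the BSTW24 twist
argument consumes — `N⁻ = q` a single prime, `N⁺ = M` arbitrary (non-square-free allowed), `t(q) = 0` —
from TWO named facts of the tree, with no CR / ♥, no surjectivity of `ρ̄_{E,p}`, no ordinarity, any `p`:

* (F1) `takahashi2001_thm_2_3_of_coprime` (`TakahashiDegreeFormula.lean`): Takahashi 2001 Thm. 2.3
  (`D = 1`) at `q ∥ N`, `N = M q`, `M` arbitrary: `δ i_q = ξ_S(M, q) j_q`, `i_q j_q = c_q = ord_q Δ_min(E)`,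
  `i_q ∣ ξ_S`, for the optimal `E` and every Brandt setup `S` of type `(M, q)`. Takahashi's standing
  hypothesis is "`N` square-free"; AT ARBITRARY `M` the identity is refereed print BY COMPOSITION, read
  first-hand in the cell `pub/bsd-litref/bstw24` (r2 TWIST-ADD-7, 8, 9, r1 MOAKHER319-ADD-3, 4; referee
  C4 ROUNDS C4-R3-ADD-12 (α) "(F1) UPGRADED to PUB-BY-COMPOSITION", -13, -14 (c)): (comp-1) Conrad–Stein
  2001 Thm. 6.1 + Prop. 6.5 + Cor. 6.6 (`#Φ_A/#Φ_X = m_A/m_X`, `#coker(Φ_J → Φ_A) = m_A/m_L` for an optimal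
  purely toric quotient of a semistable `J` with symmetric principal polarization; `lit read
  doi:10.4310/mrl.2001.v8.n6.a5` p0003:L5–L33, p0007:L50–L57, p0010:L1–L11) in the setting of their
  §7.1/§7.4 (`J = J₀(Mp)`, `p ∥ N`, `M` ARBITRARY: "the `p`-new part of `J₀(N)` has purely toric reduction
  at `p` when `p ∥ N`", p0010:L24–L34, p0011:L35–L46) — at `A = E`: `m_E = δ`, `Φ_X = ℤ/i_q`,
  `m_X = h_q/i_q`, so `δ i_q = h_q j_q`, `i_q j_q = c_q` — composed with Kohel 2001 Thm. 4.3 at `D = 1`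
  (`X(p, m) ≅ 𝒳(J₀(mp), p)` canonically, Hecke-compatibly for `(n, pm) = 1`, ISOMETRICALLY, `m` arbitrary;
  `lit read doi:10.2969/aspm/03010177` p0011:L17–L28; inner product `½|Isom(I, J)|`, p0008:L56–L60,
  = `Brandt.weight` on the diagonal): covers every instance; (comp-2) Ribet–Takahashi 1997, PROOF of
  Thm. 2 + Prop. 2 (`δ c_q = j_q² h_q` printed on `J₀^D(pqM)`, `D = 1` allowed, no square-free hypothesis
  before the "from now on" placed after Prop. 2) + Pasten 2024 Prop. 6.13, proof ("does not need `M` to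
  be squarefree … one just needs multiplicative reduction at the two primes", `lit read arxiv:1705.09251`
  p0023:L42–L56): needs a second multiplicative prime, idle. Ribet 1990 §3 is attribution (Kohel Thm.
  4.2 "proved by Ribet for `D = 1`"), not load-bearing by name.
* (F2) `ModularForms.padicValNat_congruenceNumber_eq_of_not_sq_dvd` (`CongruenceNumber.lean`): Agashe–
  Ribet–Stein 2012 Thm. 2.1 (b), `ord_p r_E = ord_p m_E` for the optimal curve when `p² ∤ N`.

From `δ i = ξ j`, `i j = c_q`, `p ∤ c_q`: `p ∤ i`, `p ∤ j`, so `ord_p δ = ord_p ξ_S`, and with (F2)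
`ord_p r_f = ord_p ξ_S` (`padicValNat_congruenceNumber_eq_xi_of_not_dvd`; `brandtXi`-valued form, a setup
existing by the PROVED `nonempty_eichlerPackage_holds`; the printed shape `… + Σ_{ℓ∣N⁻} t(ℓ)` of PW Thm. 6.8 /
Zhang Thm. 6.4 with `t(q) = 0`, and its `∀`-form `WZhang2014_thm64_prime_of_not_dvd`; consumer forms at
`N = M q`; and, last section, the identity on a PRIMITIVE GENERATOR of the eigen-line — PW's own shape).

## This is Pollack–Weston §6.5 at `r = q`, `N₂ = 1`, with Prop. 6.7 := ARS (source read first-hand)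

[PollackWeston2011] (`lit read arxiv:math/0610694`): the proof of Thm. 6.8 (p0015:L105–L122) is
`ξ_f = ⟨g_r, g_r⟩_J` (Prop. 6.5 [Kohel], p0014:L113–p0015:L10) + Prop. 6.6 (= [T]:
`ord_𝔭 δ_f(N₁,N₂) = t_f(r) + ord_𝔭 ⟨g_r, g_r⟩_J`, p0015:L30–L55) + Prop. 6.7 (`(δ_f(N)) = (η_f(N))`,
p0015:L59–L89) + Ribet–Takahashi `ord_𝔭(δ_f(N,1)/δ_f(N₁,N₂)) = Σ_{r∣N₂} t_f(r)` (p0015:L113–L120). At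
`r = q = N⁻`, `N₂ = 1`: `J = J₀(N⁺q)` is MODULAR and the [RT] sum is EMPTY. PW's own proof of Prop. 6.7
runs through their freeness Thm. 6.2 at an auxiliary ramified prime (p0015:L68–L89: "by Theorem
(thm:free) …", L77); on THIS road Prop. 6.7 := ARS 2012 Thm. 2.1 (b) (PW point there at `N₂ = 1`: "see
[AU,CK,ARS]", p0015:L57) and Props. 6.5–6.6 := Takahashi Thm. 2.3 (`D = 1`) with Kohel's dictionary;
`t_f(q) = 0` makes [Khare] / Prop. 6.4 (1) unnecessary. So no Shimura curve, no [Helm] and no freeness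
statement (PW Thm. 6.2 / Kim–Ota 2023 Thm. 5.5, Cor. 5.7 / Moakher 2024 Thm. 3.19) is USED here (cell:
r1 MOAKHER319-ADD-2 (d1), r2 TWIST-ADD-6 (Z1), C4-R3-ADD-11 (β) — three hands).

Normalisation of `ξ` (the cell's Q-TY-1, bsd-ssimc 2026-08-27): PW's `ξ_f = ⟨g_f, g_f⟩` for `g_f` a
GENERATOR of the rank-one `𝒪`-module `𝓜^f ⊆ Pic(X_{N⁺,N⁻}) ⊗ 𝒪` (p0005:L39, L57; "only defined up to a
`p`-adic unit", L60). The tree's `S.xi λ = Brandt.xi (Brandt.weight S.O) L`,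
`L = Brandt.eigenLattice (Mq) (Brandt.matrix S.O) λ ⊆ ℤ^{Cls O}` (`Brandt.xiOfOrder_eq`), is BY
DEFINITION `Σ_c w_c φ_c²` on a generator `φ` of the ℤ-line `L` (`Brandt.xi_eq_sum`; generators agree up
to sign); `L` is saturated (`Brandt.mem_eigenLattice_of_smul_mem`), so `φ` is PRIMITIVE
(`isUnit_of_forall_dvd_of_eigenLattice_eq_span`), hence a `ℤ_p`-generator of `L ⊗ ℤ_p` for every `p`, and
`ord_p ξ_S = ord_p ξ_f`; `w_c = #O_L(I_c)ˣ/2` (`Brandt.weight`) is Gross's / Kohel's `½|Isom(I_c, I_c)|`.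
In the situation below the line is honest (`exists_eigenLattice_eq_span_of_coprime`) and
`padicValNat_congruenceNumber_eq_sum_sq_of_eigenLattice_eq_span_of_not_dvd` is the identity on any
generator.

## Use (BSTW24, the quadratic-twist `μ`-step; the cell's words, not re-graded here)

Burungale–Skinner–Tian–Wan, arXiv:2409.01350v2, proof of Thm. 10.1 (`main.tex` 5926f035551c636d):
l.7421–7428 "`μ(𝓛^∘_𝒲(g/L)) = 0` by [PW, Thm. 1.2] … `(𝓛_p^{∘,ac}(g/L)) = (∏_{q∣N⁻} c_q(g) ·
𝓛^∘_𝒲(g/L))`", l.7478 "The same argument applies for the quadratic twist `g_K`": `g_K = g ⊗ χ_K` has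
level `N d_K²`, the auxiliary `L` has `q` inert and the primes of `(N/q) d_K²` split (l.7457–7459), so
`N_K⁻ = q` and the Eichler level `N_K⁺ = (N/q) d_K²` is NOT square-free. The readers located the residual
("T2b") as `ord_p(η_{g_K}(N_K)/ξ_{g_K}(N_K⁺, q)) = t_{g_K}(q) = 0` under (ram) at `q` (sheets r2 TWIST-ADD-1
(B-1)–(B-3), r1 TWIST-ADD-3 §0; C4-R3-ADD-6 (β), -8 (α)); the theorems below at (`W` := the
`X₀(N_K)`-optimal curve of the class of `E^{(d_K)}`, `M := (N/q) d_K²`, `q`) give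
`ord_p r_{g_K} = ord_p ξ(E^{(d_K)}; (N/q) d_K², q)` from `p ∤ ord_q Δ_min`, every `p ∤ N_K`, ordinary or
not. Desk words since: C4-R3-ADD-11 (β) "T2b of record = the VALUATION identity", (γ) "the degree road
reaches EVERY complement pair … class D and `p = 3` included"; C4-R3-ADD-12 (α)/(β) "(F1) UPGRADED to
PUB-BY-COMPOSITION … marker DROPS on T2b", "T2b (consumed form) = PASS-in-cell BY REFEREED PRINT on
road B1‴ for ALL 389 complement pairs … kernel carrier `padicValNat_congruenceNumber_eq_xi_of_not_dvd` BY
NAME modulo (F1), (F2)"; C4-R3-ADD-14 (c) "(comp-1) 415/415, (comp-2) 404". Residual of the complement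
`μ`-step: T2a (C1a/C1b period dictionary, bsd-ssimc `G1♮(N_K)`) ∧ GAP@3 ∧ referee A's booking — not
this file. Typed ≠ proved ≠ endorsed; nothing here proves BSD.

## References

* [PollackWeston2011] R. Pollack, T. Weston, Compos. Math. 147 (2011) 1353–1381, §2.1 (arXiv:math/0610694
  p0005:L39–L60), §6.2–6.5 (Props. 6.3–6.7, Thm. 6.8; p0014–p0015) — read.
* [Takahashi2001] S. Takahashi, J. Number Theory 90 (2001) 74–88, Thm. 2.3, p. 84 (through (F1)).
* [ConradStein2001] B. Conrad, W. A. Stein, Math. Res. Lett. 8 (2001) 745–766, §2.1, Thm. 6.1, Prop.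
  6.5, Cor. 6.6, §7.1, §7.4 — read (doi:10.4310/mrl.2001.v8.n6.a5 p0003, p0007, p0010, p0011).
* [Kohel2001] D. Kohel, Adv. Stud. Pure Math. 30 (2001) 177–195, §3.1–3.2, Thm. 4.2, Thm. 4.3 — read
  (doi:10.2969/aspm/03010177 p0007, p0008, p0011).
* [RibetTakahashi1997] K. Ribet, S. Takahashi, Proc. Natl. Acad. Sci. USA 94 (1997) 11110–11114, proof
  of Thm. 2 and Prop. 2 (read by the cell's readers on the PMC text PMC34176; PDF acq-02186).
* [PastenShimura2024] H. Pasten, J. Number Theory 254 (2024) = arXiv:1705.09251, Prop. 6.13 and its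
  proof (p0023:L42–L56) — read.
* [Ribet1990] K. Ribet, Invent. Math. 100 (1990), §3 (attribution behind Kohel Thm. 4.2; acq-09883);
  [Gross1987] B. H. Gross (1987), §§1, 3 (`⟨e_i, e_j⟩ = w_i δ_ij`; through `Brandt.weight`);
  [AgasheRibetStein2012] Thm. 2.1 (b) (through (F2)).
* [WZhang2014] W. Zhang, Camb. J. Math. 2 (2014), Thm. 6.4, Notations (v) (p. 200, ordinarity) — the
  arbitrary-level named fact `WZhang2014/DefiniteCongruenceNumber.lean`; its conclusion at `N⁻` prime,
  `t = 0`, is proved here.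
* [BSTW24] A. Burungale, C. Skinner, Y. Tian, X. Wan, arXiv:2409.01350v2, §10.2–10.3 (l.7421–7428,
  7457–7459, 7478 of `main.tex`).
-/

noncomputable section

open scoped BigOperators

namespace Literature.NumberTheory.EllipticCurves

open Literature.NumberTheory.Automorphic Literature.NumberTheory.EllipticCurves.ModularForms

/-- **`ord_p δ = ord_p ξ_S(E; M, q)` when `p ∤ c_q`** (Takahashi 2001 Thm. 2.3, `D = 1`, read
`p`-adically): for the `X₀(Mq)`-optimal elliptic curve `W/ℚ` of conductor `M q` (`q` prime,
`gcd(M, q) = 1`, `M` arbitrary), a parametrisation datum `P` of minimal degree among the data at level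
`M q` of all curves of conductor `M q` with the same newform, any Brandt setup `S` of type `(M, q)`, and
any prime `p` not dividing `c_q = ord_q Δ_min(W)` (the exponent of `q` in `|Δ_min|`): the optimal modular
degree and the definite congruence number `ξ_S = Σ_i w_i g_i²` have the same `p`-adic valuation. From
`δ i_q = ξ_S j_q`, `i_q j_q = c_q` (the named fact `takahashi2001_thm_2_3_of_coprime`, hypothesis `hT`):
`p ∤ c_q` forces `p ∤ i_q`, `p ∤ j_q`. PROVED modulo that named fact.
[cite: Takahashi2001, Thm. 2.3 (p. 79), remark p. 80, p. 84] [cite: PastenShimura2024, Prop. 6.13] -/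
theorem padicValNat_modularDegree_eq_xi_of_not_dvd (hT : takahashi2001_thm_2_3_of_coprime)
    (W : WeierstrassCurve ℚ) [W.IsElliptic] (M q : ℕ) [NeZero (M * q)] (hq : q.Prime)
    (hMq : M.Coprime q) (hN : W.conductorNorm ℤ = M * q) (P : ModularParametrizationData W (M * q))
    (hP : ∀ (W' : WeierstrassCurve ℚ) [W'.IsElliptic], W'.conductorNorm ℤ = M * q →
      ∀ P' : ModularParametrizationData W' (M * q), P'.f = P.f → P.modularDegree ≤ P'.modularDegree)
    {p : ℕ} [Fact p.Prime] (hram : ¬ p ∣ (W.minimalDiscriminantNorm ℤ).factorization q)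
    (S : Brandt.XiSetup M q) :
    padicValNat p P.modularDegree = padicValNat p (S.xi fun n => W.LFunction n) := by
  obtain ⟨i, j, hi, hij, -, hδ⟩ := hT W M q hq hMq hN P hP S
  have hpi : ¬ p ∣ i := fun h => hram (hij ▸ dvd_mul_of_dvd_left h j)
  have hpj : ¬ p ∣ j := fun h => hram (hij ▸ dvd_mul_of_dvd_right h i)
  have hδ0 : P.modularDegree ≠ 0 := P.deg_pos.ne'
  have hδi : P.modularDegree * i ≠ 0 := mul_ne_zero hδ0 hi.ne'
  have hj0 : j ≠ 0 := by
    rintro rfl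
    exact hδi (by rw [hδ, mul_zero])
  have hξ0 : (S.xi fun n => W.LFunction n) ≠ 0 := by
    intro h0
    exact hδi (by rw [hδ, h0, zero_mul])
  have h := congrArg (padicValNat p) hδ
  rwa [padicValNat.mul hδ0 hi.ne', padicValNat.mul hξ0 hj0,
    padicValNat.eq_zero_of_not_dvd hpi, padicValNat.eq_zero_of_not_dvd hpj] at h

/-- **`ord_p η_f(Mq) = ord_p ξ_S(E; M, q)` when `p ∤ Mq` and `p ∤ c_q`** — the definite Ribet–Takahashi /
Pollack–Weston Thm. 6.8 identity at a PRIME `N⁻ = q` and ARBITRARY `N⁺ = M` (`gcd(M, q) = 1`), in the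
case `t_f(q) = ord_p c_q = 0`, for the `X₀(Mq)`-optimal curve `W` (datum `P` of minimal degree among all
data at level `M q` with the same newform; `f = P.f`, `r_f = congruenceNumber P.f = η_f(Mq)` up to a
`p`-adic unit, ARS §3 / DDT §4.4 as recorded in `RibetTakahashiDefinite.lean`), every Brandt setup `S`
of type `(M, q)` and every prime `p ∤ M q` with `p ∤ ord_q Δ_min(W)`. PROVED modulo the named facts
`takahashi2001_thm_2_3_of_coprime` (`hT`) and `padicValNat_congruenceNumber_eq_of_not_sq_dvd` (`hARS`,
ARS 2012 Thm. 2.1 (b), used at `p² ∤ Mq`). No CR, no surjectivity of `ρ̄_{E,p}`, no ordinarity, any `p`.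
This is Pollack–Weston's §6.5 argument at `r = q`, `N₂ = 1` (module docstring).
[cite: PollackWeston2011, Thm. 6.8 with Props. 6.5–6.7 (§6.5, case `N⁻ = q`)]
[cite: Takahashi2001, Thm. 2.3 (p. 79)] [cite: AgasheRibetStein2012, Thm. 2.1] -/
theorem padicValNat_congruenceNumber_eq_xi_of_not_dvd (hT : takahashi2001_thm_2_3_of_coprime)
    (hARS : padicValNat_congruenceNumber_eq_of_not_sq_dvd)
    (W : WeierstrassCurve ℚ) [W.IsElliptic] (M q : ℕ) [NeZero (M * q)] (hq : q.Prime)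
    (hMq : M.Coprime q) (hN : W.conductorNorm ℤ = M * q) (P : ModularParametrizationData W (M * q))
    (hD : ∀ (W' : WeierstrassCurve ℚ) [W'.IsElliptic] (P' : ModularParametrizationData W' (M * q)),
      P'.f = P.f → P.modularDegree ≤ P'.modularDegree)
    (p : ℕ) [Fact p.Prime] (hpN : ¬ p ∣ M * q)
    (hram : ¬ p ∣ (W.minimalDiscriminantNorm ℤ).factorization q) (S : Brandt.XiSetup M q) :
    padicValNat p (congruenceNumber P.f) = padicValNat p (S.xi fun n => W.LFunction n) := by
  have hp : p.Prime := Fact.out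
  have hp2 : ¬ p ^ 2 ∣ M * q := fun h => hpN (dvd_trans (dvd_pow_self p two_ne_zero) h)
  rw [hARS W (M * q) P hD p hp hp2]
  exact padicValNat_modularDegree_eq_xi_of_not_dvd hT W M q hq hMq hN P
    (fun W' _ _ P' hP' => hD W' P' hP') hram S

/-- A Brandt setup of type `(M, q)` exists for `M ≥ 1` and a prime `q ∤ M` (a definite quaternion
algebra over `ℚ` of discriminant `q` with an Eichler order of level `M`): the PROVED existence theorem
`nonempty_eichlerPackage_holds` (Vignéras III Thm. 3.1, II §2, III §5) through
`Brandt.nonempty_xiSetup_of_nonempty_eichlerPackage`. [cite: VignerasLNM800, Ch. III §3 Thm. 3.1 and §5 Prop. 5.1] -/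
theorem nonempty_xiSetup_of_prime {M q : ℕ} (hM : 0 < M) (hq : q.Prime) (hMq : M.Coprime q) :
    Nonempty (Brandt.XiSetup M q) :=
  Brandt.nonempty_xiSetup_of_nonempty_eichlerPackage nonempty_eichlerPackage_holds hM
    hq.prime.squarefree (by rw [Nat.Prime.primeFactors hq, Finset.card_singleton]; exact odd_one) hMq

/-- **`ord_p η_f(Mq) = ord_p ξ(E; M, q)`** (`ξ = BrandtModuleJLSelfPairing W M q = brandtXi M q (a(E))`,
the value on the chosen setup — the rendering of `PollackWeston2011.thm_6_8_ellipticCurve` and of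
`WZhang2014.thm64_padicValNat_congruenceNumber_eq`) for the optimal curve `W` of conductor `M q`,
`q` prime, `gcd(M, q) = 1`, `M` arbitrary, and any prime `p ∤ M q` with `p ∤ ord_q Δ_min(W)`; a setup
exists by `nonempty_xiSetup_of_prime`. PROVED modulo `hT`, `hARS`.
[cite: PollackWeston2011, Thm. 6.8 (§6.5, case `N⁻ = q`)] [cite: Takahashi2001, Thm. 2.3 (p. 79)]
[cite: AgasheRibetStein2012, Thm. 2.1] -/
theorem padicValNat_congruenceNumber_eq_brandtModuleJLSelfPairing_of_not_dvd
    (hT : takahashi2001_thm_2_3_of_coprime) (hARS : padicValNat_congruenceNumber_eq_of_not_sq_dvd)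
    (W : WeierstrassCurve ℚ) [W.IsElliptic] (M q : ℕ) [NeZero (M * q)] (hq : q.Prime)
    (hMq : M.Coprime q) (hN : W.conductorNorm ℤ = M * q) (P : ModularParametrizationData W (M * q))
    (hD : ∀ (W' : WeierstrassCurve ℚ) [W'.IsElliptic] (P' : ModularParametrizationData W' (M * q)),
      P'.f = P.f → P.modularDegree ≤ P'.modularDegree)
    (p : ℕ) [Fact p.Prime] (hpN : ¬ p ∣ M * q)
    (hram : ¬ p ∣ (W.minimalDiscriminantNorm ℤ).factorization q) :
    padicValNat p (congruenceNumber P.f) = padicValNat p (BrandtModuleJLSelfPairing W M q) := by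
  have hM : 0 < M := Nat.pos_of_ne_zero (left_ne_zero_of_mul (NeZero.ne (M * q)))
  obtain ⟨S, hS⟩ := exists_brandtModuleJLSelfPairing_eq W (nonempty_xiSetup_of_prime hM hq hMq)
  rw [hS]
  exact padicValNat_congruenceNumber_eq_xi_of_not_dvd hT hARS W M q hq hMq hN P hD p hpN hram S

/-- **Pollack–Weston Thm. 6.8 / W. Zhang Thm. 6.4 in their printed shape at a prime `N⁻ = q`,
arbitrary `N⁺ = M`, when `t(q) = 0`:** `ord_p r_f = ord_p ξ(E; M, q) + Σ_{ℓ ∣ q} t_E(p; ℓ)` — the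
conclusion of `WZhang2014.thm64_padicValNat_congruenceNumber_eq` (and of `PollackWeston2011_thm_6_8`)
at `Nplus = M`, `Nminus = q` — from `p ∤ ord_q Δ_min(W)` ALONE (no hypothesis ♥ / CR beyond this, no
surjectivity, no `p ≥ 5`, no ordinarity — Zhang's standing Notations (v), p. 200, "The modular form
`g` is assumed to be good ordinary at `𝔭`", is not needed on this road); the sum is the single term
`tamagawaExponent W p q = ord_p(ord_q Δ_min) = 0`. PROVED modulo `hT`, `hARS`.
[cite: PollackWeston2011, Thm. 6.8 (§6.5, case `N⁻ = q`)] [cite: WZhang2014, Thm. 6.4 (pp. 229–230)]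
[cite: Takahashi2001, Thm. 2.3 (p. 79)] [cite: AgasheRibetStein2012, Thm. 2.1] -/
theorem padicValNat_congruenceNumber_eq_add_sum_tamagawaExponent_of_prime_of_not_dvd
    (hT : takahashi2001_thm_2_3_of_coprime) (hARS : padicValNat_congruenceNumber_eq_of_not_sq_dvd)
    (W : WeierstrassCurve ℚ) [W.IsElliptic] (M q : ℕ) [NeZero (M * q)] (hq : q.Prime)
    (hMq : M.Coprime q) (hN : W.conductorNorm ℤ = M * q) (P : ModularParametrizationData W (M * q))
    (hD : ∀ (W' : WeierstrassCurve ℚ) [W'.IsElliptic] (P' : ModularParametrizationData W' (M * q)),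
      P'.f = P.f → P.modularDegree ≤ P'.modularDegree)
    (p : ℕ) [Fact p.Prime] (hpN : ¬ p ∣ M * q)
    (hram : ¬ p ∣ (W.minimalDiscriminantNorm ℤ).factorization q) :
    padicValNat p (congruenceNumber P.f) =
      padicValNat p (BrandtModuleJLSelfPairing W M q) + ∑ ℓ ∈ q.primeFactors, tamagawaExponent W p ℓ := by
  have hp : p.Prime := Fact.out
  have ht : tamagawaExponent W p q = 0 := by
    rw [tamagawaExponent_eq_factorization W hp hq]
    exact Nat.factorization_eq_zero_of_not_dvd hram
  rw [Nat.Prime.primeFactors hq, Finset.sum_singleton, ht, add_zero]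
  exact padicValNat_congruenceNumber_eq_brandtModuleJLSelfPairing_of_not_dvd hT hARS W M q hq hMq hN P
    hD p hpN hram

/-! ### The same at a level `N` given as an equation `N = M q` (consumer form), and the
`∀`-statement in the binder shape of `WZhang2014.thm64_padicValNat_congruenceNumber_eq` -/

/-- `padicValNat_congruenceNumber_eq_xi_of_not_dvd` at a level `N` with `N = M q` supplied as an
equation, so that a parametrisation datum `P : ModularParametrizationData W N` (e.g. at a numeral
level) is used without transport. PROVED modulo `hT`, `hARS`.
[cite: PollackWeston2011, Thm. 6.8 (§6.5, case `N⁻ = q`)] [cite: Takahashi2001, Thm. 2.3 (p. 79)]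
[cite: AgasheRibetStein2012, Thm. 2.1] -/
theorem padicValNat_congruenceNumber_eq_xi_of_eq_mul_of_not_dvd
    (hT : takahashi2001_thm_2_3_of_coprime) (hARS : padicValNat_congruenceNumber_eq_of_not_sq_dvd)
    {N : ℕ} [NeZero N] (W : WeierstrassCurve ℚ) [W.IsElliptic] {M q : ℕ} (hNe : N = M * q)
    (hq : q.Prime) (hMq : M.Coprime q) (hN : W.conductorNorm ℤ = N) (P : ModularParametrizationData W N)
    (hD : ∀ (W' : WeierstrassCurve ℚ) [W'.IsElliptic] (P' : ModularParametrizationData W' N),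
      P'.f = P.f → P.modularDegree ≤ P'.modularDegree)
    (p : ℕ) [Fact p.Prime] (hpN : ¬ p ∣ N) (hram : ¬ p ∣ (W.minimalDiscriminantNorm ℤ).factorization q)
    (S : Brandt.XiSetup M q) :
    padicValNat p (congruenceNumber P.f) = padicValNat p (S.xi fun n => W.LFunction n) := by
  subst hNe
  exact padicValNat_congruenceNumber_eq_xi_of_not_dvd hT hARS W M q hq hMq hN P hD p hpN hram S

/-- `padicValNat_congruenceNumber_eq_brandtModuleJLSelfPairing_of_not_dvd` at a level `N = M q` given
as an equation. PROVED modulo `hT`, `hARS`. [cite: PollackWeston2011, Thm. 6.8 (§6.5, case `N⁻ = q`)]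
[cite: Takahashi2001, Thm. 2.3 (p. 79)] [cite: AgasheRibetStein2012, Thm. 2.1] -/
theorem padicValNat_congruenceNumber_eq_brandtModuleJLSelfPairing_of_eq_mul_of_not_dvd
    (hT : takahashi2001_thm_2_3_of_coprime) (hARS : padicValNat_congruenceNumber_eq_of_not_sq_dvd)
    {N : ℕ} [NeZero N] (W : WeierstrassCurve ℚ) [W.IsElliptic] {M q : ℕ} (hNe : N = M * q)
    (hq : q.Prime) (hMq : M.Coprime q) (hN : W.conductorNorm ℤ = N) (P : ModularParametrizationData W N)
    (hD : ∀ (W' : WeierstrassCurve ℚ) [W'.IsElliptic] (P' : ModularParametrizationData W' N),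
      P'.f = P.f → P.modularDegree ≤ P'.modularDegree)
    (p : ℕ) [Fact p.Prime] (hpN : ¬ p ∣ N) (hram : ¬ p ∣ (W.minimalDiscriminantNorm ℤ).factorization q) :
    padicValNat p (congruenceNumber P.f) = padicValNat p (BrandtModuleJLSelfPairing W M q) := by
  subst hNe
  exact padicValNat_congruenceNumber_eq_brandtModuleJLSelfPairing_of_not_dvd hT hARS W M q hq hMq hN P
    hD p hpN hram

/-- **W. Zhang 2014 Thm. 6.4 / Pollack–Weston 2011 Thm. 6.8 at a PRIME `N⁻`, in the `∀`-shape of the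
tree's binder `WZhang2014.thm64_padicValNat_congruenceNumber_eq`, from (ram) at `N⁻` alone** — for every
elliptic `W/ℚ` of conductor `N⁺N⁻` with `N⁻` PRIME and `gcd(N⁺, N⁻) = 1` (`N⁺` arbitrary), every prime
`p ∤ N⁺N⁻` with `p ∤ ord_{N⁻} Δ_min(W)` (the binder's ♥(1) clause at `q = N⁻`, here for every residue of
`N⁻ mod p`), and every datum `D` of minimal degree among all data at level `N⁺N⁻` with the same newform:
`ord_p r_{D.f} = ord_p ξ(E; N⁺, N⁻) + Σ_{ℓ ∣ N⁻} t_E(p; ℓ)`. Compared with the binder: NO `5 ≤ p`, NO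
`HasSurjectiveModNGaloisRep`, NO ♥(1) at the primes `ℓ ∥ N⁺`, NO ♥(2), and no ordinarity (Zhang's
standing Notations (v)); in exchange `N⁻` is a single prime and `t(N⁻) = 0`. PROVED modulo `hT`, `hARS`
(Takahashi 2001 Thm. 2.3 + ARS 2012 Thm. 2.1 (b)); the binder itself (arbitrary square-free `N⁻`,
♥) is NOT discharged. [cite: WZhang2014, Thm. 6.4 (pp. 229–230), case `ν(N⁻) = 1`]
[cite: PollackWeston2011, Thm. 6.8 (§6.5, case `N⁻ = q`)] [cite: Takahashi2001, Thm. 2.3 (p. 79)]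
[cite: AgasheRibetStein2012, Thm. 2.1] -/
theorem WZhang2014_thm64_prime_of_not_dvd (hT : takahashi2001_thm_2_3_of_coprime)
    (hARS : padicValNat_congruenceNumber_eq_of_not_sq_dvd) :
    ∀ (W : WeierstrassCurve ℚ) [W.IsElliptic] (Nplus Nminus : ℕ) [NeZero (Nplus * Nminus)],
      W.conductorNorm ℤ = Nplus * Nminus → Nat.Coprime Nplus Nminus → Nminus.Prime →
      ∀ p : ℕ, p.Prime → ¬ p ∣ Nplus * Nminus →
        ¬ p ∣ (W.minimalDiscriminantNorm ℤ).factorization Nminus →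
        ∀ D : ModularParametrizationData W (Nplus * Nminus),
          (∀ (W' : WeierstrassCurve ℚ) [W'.IsElliptic]
              (D' : ModularParametrizationData W' (Nplus * Nminus)),
              D'.f = D.f → D.modularDegree ≤ D'.modularDegree) →
          padicValNat p (congruenceNumber D.f) =
            padicValNat p (BrandtModuleJLSelfPairing W Nplus Nminus) +
              ∑ ℓ ∈ Nminus.primeFactors, tamagawaExponent W p ℓ := by
  intro W _ Nplus Nminus _ hN hcop hq p hp hpN hram D hD
  haveI : Fact p.Prime := ⟨hp⟩
  exact padicValNat_congruenceNumber_eq_add_sum_tamagawaExponent_of_prime_of_not_dvd hT hARS W Nplus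
    Nminus hq hcop hN D hD p hpN hram

/-! ### The eigen-line and its generator: `ξ_S = Σ_c w_c φ_c²` on a PRIMITIVE generator (Pollack–Weston
§2.1 "`𝓜^f` is a free `𝒪`-module of rank 1; let `g_f` denote a generator … `ξ_f = ⟨g_f, g_f⟩`") -/

/-- **A generator of the eigen-lattice is primitive.** If `L = Brandt.eigenLattice N T λ ⊆ ℤ^ι` is the
line `ℤ ∙ φ` and `d ∈ ℤ` divides every coordinate of `φ`, then `d = ±1`: `L` is saturated
(`Brandt.mem_eigenLattice_of_smul_mem`), so `φ/d ∈ L = ℤφ`. Hence `φ` generates `L ⊗ ℤ_p = ℤ_p^ι ∩ ℚ_p φ`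
for every prime `p` (pick `n ∈ ℤ^ι` with `Σ n_i φ_i = 1`), i.e. it is PW's `g_f` up to a `p`-adic unit
(arXiv:math/0610694 p0005:L39 "let `g_f` denote a generator", L60 "only defined up to a `p`-adic unit"),
so `Brandt.xi w L = Σ_i w_i φ_i²` has the valuation of `ξ_f = ⟨g_f, g_f⟩` (L57). [cite: PollackWeston2011, §2.1] -/
theorem isUnit_of_forall_dvd_of_eigenLattice_eq_span {ι : Type*} [Fintype ι] {N : ℕ}
    {T : ℕ → Matrix ι ι ℤ} {lam : ℕ → ℤ} {φ : ι → ℤ} (hφ : φ ≠ 0)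
    (hL : Brandt.eigenLattice N T lam = ℤ ∙ φ) {d : ℤ} (hd : ∀ i, d ∣ φ i) : IsUnit d := by
  choose v hv using hd
  have hφv : φ = d • v := funext fun i => by rw [Pi.smul_apply, smul_eq_mul]; exact hv i
  have hd0 : d ≠ 0 := by
    rintro rfl
    exact hφ (by rw [hφv, zero_smul])
  have hvL : v ∈ Brandt.eigenLattice N T lam :=
    Brandt.mem_eigenLattice_of_smul_mem hd0
      (by rw [← hφv, hL]; exact Submodule.mem_span_singleton_self φ)
  rw [hL] at hvL
  obtain ⟨a, ha⟩ := Submodule.mem_span_singleton.mp hvL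
  have h1 : (d * a) • φ = φ := by rw [mul_smul, ha, ← hφv]
  have h2 : (d * a - 1) • φ = 0 := by rw [sub_smul, one_smul, h1, sub_self]
  exact isUnit_iff_exists_inv.mpr ⟨a, sub_eq_zero.mp ((smul_eq_zero.mp h2).resolve_right hφ)⟩

/-- **The `a(W)`-eigen-lattice of the Brandt matrices is an honest line** in the situation of (F1) (`W`
the `X₀(Mq)`-optimal curve of conductor `M q`, `q` prime, `gcd(M, q) = 1`, any Brandt setup `S` of type
`(M, q)`): `Brandt.eigenLattice (Mq) (Brandt.matrix S.O) (a(W)) = ℤ ∙ φ`, `φ ≠ 0` — Takahashi p. 78 "`L_r(J)`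
is a free `ℤ`-module of rank one", PW §2.1 "`𝓜^f` is a free `𝒪`-module of rank 1". From the fact: `δ i = ξ_S j`
with `δ, i ≥ 1` forces `ξ_S ≠ 0`, and `Brandt.xi` is `0` off lines (`Brandt.xi_of_not_isLine`). PROVED modulo
`hT`. [cite: Takahashi2001, §2 p. 78 and Thm. 2.3 (p. 79)] [cite: PollackWeston2011, §2.1] -/
theorem exists_eigenLattice_eq_span_of_coprime (hT : takahashi2001_thm_2_3_of_coprime)
    (W : WeierstrassCurve ℚ) [W.IsElliptic] (M q : ℕ) [NeZero (M * q)] (hq : q.Prime)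
    (hMq : M.Coprime q) (hN : W.conductorNorm ℤ = M * q) (P : ModularParametrizationData W (M * q))
    (hP : ∀ (W' : WeierstrassCurve ℚ) [W'.IsElliptic], W'.conductorNorm ℤ = M * q →
      ∀ P' : ModularParametrizationData W' (M * q), P'.f = P.f → P.modularDegree ≤ P'.modularDegree)
    (S : Brandt.XiSetup M q) [Fintype (Brandt.ClassSet S.O)] :
    ∃ φ : Brandt.ClassSet S.O → ℤ, φ ≠ 0 ∧
      Brandt.eigenLattice (M * q) (Brandt.matrix S.O) (fun n => W.LFunction n) = ℤ ∙ φ := by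
  by_contra h
  obtain ⟨i, j, hi, -, -, hδ⟩ := hT W M q hq hMq hN P hP S
  have h0 : S.xi (fun n => W.LFunction n) = 0 := by
    rw [Brandt.XiSetup.xi, Brandt.xiOfOrder_eq]
    exact Brandt.xi_of_not_isLine _ h
  rw [h0, zero_mul] at hδ
  exact (Nat.mul_pos P.deg_pos hi).ne' hδ

/-- **`ord_p r_f = ord_p Σ_c w_c φ_c²` for EVERY generator `φ` of the `a(W)`-line** — the identity
`padicValNat_congruenceNumber_eq_xi_of_not_dvd` written on a generator, i.e. literally Pollack–Weston's
`(η_f(N))_𝔭 = (ξ_f(N⁺, N⁻))_𝔭`, `ξ_f = ⟨g_f, g_f⟩`, at `N⁻ = q` prime, `t_f(q) = 0`, `N⁺ = M` arbitrary (`φ` is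
primitive, hence a `ℤ_p`-generator `g_f`; generators exist by `exists_eigenLattice_eq_span_of_coprime`).
PROVED modulo `hT`, `hARS`. [cite: PollackWeston2011, §2.1 and Thm. 6.8 (§6.5, case `N⁻ = q`)]
[cite: Takahashi2001, Thm. 2.3] [cite: ConradStein2001, Thm. 6.1, §7.1] [cite: AgasheRibetStein2012, Thm. 2.1] -/
theorem padicValNat_congruenceNumber_eq_sum_sq_of_eigenLattice_eq_span_of_not_dvd
    (hT : takahashi2001_thm_2_3_of_coprime) (hARS : padicValNat_congruenceNumber_eq_of_not_sq_dvd)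
    (W : WeierstrassCurve ℚ) [W.IsElliptic] (M q : ℕ) [NeZero (M * q)] (hq : q.Prime)
    (hMq : M.Coprime q) (hN : W.conductorNorm ℤ = M * q) (P : ModularParametrizationData W (M * q))
    (hD : ∀ (W' : WeierstrassCurve ℚ) [W'.IsElliptic] (P' : ModularParametrizationData W' (M * q)),
      P'.f = P.f → P.modularDegree ≤ P'.modularDegree)
    (p : ℕ) [Fact p.Prime] (hpN : ¬ p ∣ M * q)
    (hram : ¬ p ∣ (W.minimalDiscriminantNorm ℤ).factorization q) (S : Brandt.XiSetup M q)
    [Fintype (Brandt.ClassSet S.O)] {φ : Brandt.ClassSet S.O → ℤ} (hφ : φ ≠ 0)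
    (hL : Brandt.eigenLattice (M * q) (Brandt.matrix S.O) (fun n => W.LFunction n) = ℤ ∙ φ) :
    padicValNat p (congruenceNumber P.f) =
      padicValNat p (∑ c, Brandt.weight S.O c * (φ c).natAbs ^ 2) := by
  rw [padicValNat_congruenceNumber_eq_xi_of_not_dvd hT hARS W M q hq hMq hN P hD p hpN hram S,
    Brandt.XiSetup.xi, Brandt.xiOfOrder_eq, Brandt.xi_eq_sum _ hφ hL]

/-- **Pollack–Weston's sentence in one statement** (`N⁻ = q` prime, `N⁺ = M` arbitrary, `t_f(q) = 0`):
there is a PRIMITIVE generator `g` of the `a(W)`-line of the Brandt module of `S` (every common divisor of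
its coordinates is a unit, so `g` generates the line over `ℤ_p` for every `p`) and `ord_p r_f = ord_p ⟨g, g⟩
= ord_p Σ_c w_c g_c²`. PROVED modulo `hT`, `hARS`. [cite: PollackWeston2011, §2.1 and Thm. 6.8 (§6.5)]
[cite: Takahashi2001, Thm. 2.3 (p. 79)] [cite: ConradStein2001, Thm. 6.1, §7.1] [cite: AgasheRibetStein2012, Thm. 2.1] -/
theorem exists_primitive_generator_padicValNat_congruenceNumber_eq_of_not_dvd
    (hT : takahashi2001_thm_2_3_of_coprime) (hARS : padicValNat_congruenceNumber_eq_of_not_sq_dvd)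
    (W : WeierstrassCurve ℚ) [W.IsElliptic] (M q : ℕ) [NeZero (M * q)] (hq : q.Prime)
    (hMq : M.Coprime q) (hN : W.conductorNorm ℤ = M * q) (P : ModularParametrizationData W (M * q))
    (hD : ∀ (W' : WeierstrassCurve ℚ) [W'.IsElliptic] (P' : ModularParametrizationData W' (M * q)),
      P'.f = P.f → P.modularDegree ≤ P'.modularDegree)
    (p : ℕ) [Fact p.Prime] (hpN : ¬ p ∣ M * q)
    (hram : ¬ p ∣ (W.minimalDiscriminantNorm ℤ).factorization q) (S : Brandt.XiSetup M q)
    [Fintype (Brandt.ClassSet S.O)] :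
    ∃ g : Brandt.ClassSet S.O → ℤ, g ≠ 0 ∧
      Brandt.eigenLattice (M * q) (Brandt.matrix S.O) (fun n => W.LFunction n) = ℤ ∙ g ∧
      (∀ d : ℤ, (∀ c, d ∣ g c) → IsUnit d) ∧
      padicValNat p (congruenceNumber P.f) =
        padicValNat p (∑ c, Brandt.weight S.O c * (g c).natAbs ^ 2) := by
  obtain ⟨g, hg, hL⟩ := exists_eigenLattice_eq_span_of_coprime hT W M q hq hMq hN P
    (fun W' _ _ P' hP' => hD W' P' hP') S
  exact ⟨g, hg, hL, fun _ hd => isUnit_of_forall_dvd_of_eigenLattice_eq_span hg hL hd,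
    padicValNat_congruenceNumber_eq_sum_sq_of_eigenLattice_eq_span_of_not_dvd hT hARS W M q hq hMq hN P
      hD p hpN hram S hg hL⟩

end Literature.NumberTheory.EllipticCurves

end
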